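import Summits.ABC.IUTFork.Conditional.Layer1OfSa
import Summits.ABC.IUTFork.Conditional.Layer1OfSb
import Summits.ABC.IUTFork.Conditional.Layer1OfSbV2
import HarnessLib

/-!
# L1 layer certificate — TOP: `Layer1Residual` / `layer1Cone_of` (director-abc (C2); abc-iut-L1-lead R121 (5) «CERT-L1»)

COUNT LINE (L1, both parts; grammar of `Conditional/Layer6OfS.lean`): **L1 cone 176 = A ([FrdI] §1–§3) 84 + B ([FrdI] §4–§6, [FrdII]) 92 =
Discharged 88 claim nodes (A 43 + B 45; NODES-DISCHARGED incl. the tags DISCHARGED-(H), DISCHARGED-partial, DISCHARGED-conditional,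
DISCHARGED-bound, kept per line in the parts) + r 17 (Residual conjuncts = claim-form index Props of nodes NODES does not mark discharged:
A 7 + B 10 — all typed-ACCEPTED Definitions except [FrdI] Prop 2.2 (ii)/(iii)) + d_data 67 (data-form index aliases, listed in the parts:
A 30 + B 37) + findings 4 (A: `N_FrdI_Def3_1_i…iv` mis-keyed, R121 (6)) + refuted-as-typed 1 (B: [FrdI] Prop 4.4 (iii), listed)**;
46 discharge SUB-ROWS with `_holds` are conjoined next to their nodes (A 9 + B 37). S consumed at L1: NO (S = `PilotKummerIndRelated` enters
at the Cor. 3.12 node); FACT-LIST facts as FREE hypotheses of the certificate: none — named inputs are bound INSIDE the conjoined statements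
(instance forms). Status source plan/L1/NODES.md overlay #43 (2026-08-26T06:40Z); node list plan/CONE-BOARD.tsv ⋈ plan/COR312-CONE.tsv;
kernel index abc-iut-c312-2's `Summits/ABC/IUTFork/DAGL1*.lean` + `DAGUa/DAGUb`; parts of record p429833 (A) · p429996 (B).

WHAT THIS FILE IS. abc-iut cell, seat abc-iut-L1-d4 (gen 5), row CERT-L1. It imports the two parts and offers the apex
`Conditional/AbcOfS.lean` (abc-iut-plan / C-cert) ONE binder for layer L1: `(h1 : Layer1Residual)`; `layer1Cone_of h1` then yields both
slices of the L1 cone (`Layer1ConeA ∧ Layer1ConeB`), the discharged halves being kernel theorems cited BY NAME. Every later L1 discharge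
(a NODES overlay) moves one conjunct from a part's Residual to its Discharged (that part re-filed whole, this top untouched unless a universe
arity changes). Universe levels: the index's names, shared — `Layer1ResidualA.{u₁, …, u₅}`, `Layer1ResidualB.{u₁, u₂}`,
`Layer1DischargedB.{u₁, …, u₁₆}`.
HONEST FRAMING: proves nothing new, asserts nothing about [IUTchIII] Cor. 3.12; typed ≠ proved; indexed ≠ endorsed; no side taken;
nothing here says abc is proved or refuted. [claim: Mochizuki2012, status: disputed] (node texts). Version: v1 2026-08-26T07:0xZ.
-/

namespace Summit.ABC.IUTFork.Conditional

universe u₁ u₂ u₃ u₄ u₅ u₆ u₇ u₈ u₉ u₁₀ u₁₁ u₁₂ u₁₃ u₁₄ u₁₅ u₁₆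

/-- **L1 residual** = the C-scoreboard entries of layer L1: `Layer1ResidualA` ([FrdI] §1–§3, 7 conjuncts) ∧ `Layer1ResidualB`
([FrdI] §4–§6 + [FrdII], 10 conjuncts). The ONE binder the apex takes for L1. [claim: Mochizuki2012, status: disputed] -/
def Layer1Residual : Prop :=
  Layer1ResidualA.{u₁, u₂, u₃, u₄, u₅} ∧ Layer1ResidualB.{u₁, u₂}

/-- **L1 discharged** = `Layer1DischargedA` ∧ `Layer1DischargedB` (A 43 + B 45 nodes + sub-rows), a kernel theorem by the parts' witnesses
BY NAME. [claim: Mochizuki2012, status: disputed] -/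
def Layer1Discharged : Prop :=
  Layer1DischargedA.{u₁, u₂, u₃, u₄, u₅} ∧
    Layer1DischargedB.{u₁, u₂, u₃, u₄, u₅, u₆, u₇, u₈, u₉, u₁₀, u₁₁, u₁₂, u₁₃, u₁₄, u₁₅, u₁₆}

/-- `Layer1Discharged` holds (both halves are proved in the parts; nothing new here). [claim: Mochizuki2012, status: disputed] -/
theorem layer1Discharged_holds :
    Layer1Discharged.{u₁, u₂, u₃, u₄, u₅, u₆, u₇, u₈, u₉, u₁₀, u₁₁, u₁₂, u₁₃, u₁₄, u₁₅, u₁₆} :=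
  ⟨layer1DischargedA_holds, layer1DischargedB_holds⟩

/-- **The whole L1 slice of the Cor. 3.12 cone from its residual alone**: `Layer1Residual → Layer1ConeA ∧ Layer1ConeB`.
[claim: Mochizuki2012, status: disputed] -/
theorem layer1Cone_of (h : Layer1Residual.{u₁, u₂, u₃, u₄, u₅}) :
    Layer1ConeA.{u₁, u₂, u₃, u₄, u₅} ∧
      Layer1ConeB.{u₁, u₂, u₃, u₄, u₅, u₆, u₇, u₈, u₉, u₁₀, u₁₁, u₁₂, u₁₃, u₁₄, u₁₅, u₁₆} :=
  ⟨layer1ConeA_of h.1, layer1ConeB_of h.2⟩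

/-! ## v2 (append-only; abc-iut-L1-d4 gen 5, 2026-08-26T09:2xZ)

v1 (p430020) printed «Discharged 88 / r 17»; the parts' v2 (index RE-KEY swap of abc-iut-c312-2 08:52:10Z: [FrdI] Def 3.1 (i)–(iv) →
`N_FrdI_Def3_1_*'`, Thm 5.1 (i)–(iv) → `N_FrdI_Thm5_1_*'`) give the L1 COUNT LINE OF RECORD:
**176 = Discharged 90 (A 43 + B 47) + Residual 18 (A 9 + B 9) + d_data 67 (A 32 + B 35) + findings 0 + refuted-as-typed 1**
(46 discharge sub-rows conjoined: A 9 + B 37; part B's v2 declarations live in `Conditional/Layer1OfSbV2.lean`, part A's in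
`Conditional/Layer1OfSa.lean` §v2).  New declarations (v1's stay verbatim): `Layer1Residual_v2 := Layer1ResidualA_v2 ∧
Layer1ResidualB` (18 conjuncts — THE binder the apex `Conditional/AbcOfS` should take for L1 from now on), `Layer1Discharged_v2`,
`layer1Discharged_v2_holds`, `layer1Cone_v2_of : Layer1Residual_v2 → Layer1ConeA_v2 ∧ Layer1ConeB_v2`.
[claim: Mochizuki2012, status: disputed] -/

/-- **L1 residual, v2** = `Layer1ResidualA_v2` (9 conjuncts) ∧ `Layer1ResidualB` (9 conjuncts): the ONE binder the apex takes for L1.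
[claim: Mochizuki2012, status: disputed] -/
def Layer1Residual_v2 : Prop :=
  Layer1ResidualA_v2.{u₁, u₂, u₃, u₄, u₅} ∧ Layer1ResidualB.{u₁, u₂}

/-- **L1 discharged, v2** = `Layer1DischargedA` ∧ `Layer1DischargedB_v2` (A 43 + B 47 nodes + sub-rows). [claim: Mochizuki2012, status: disputed] -/
def Layer1Discharged_v2 : Prop :=
  Layer1DischargedA.{u₁, u₂, u₃, u₄, u₅} ∧ Layer1DischargedB_v2.{u₁, u₂, u₃, u₄, u₅, u₆, u₇, u₈, u₉, u₁₀, u₁₁, u₁₂, u₁₃, u₁₄, u₁₅, u₁₆}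

/-- `Layer1Discharged_v2` holds (both halves are proved in the parts; nothing new here). [claim: Mochizuki2012, status: disputed] -/
theorem layer1Discharged_v2_holds : Layer1Discharged_v2.{u₁, u₂, u₃, u₄, u₅, u₆, u₇, u₈, u₉, u₁₀, u₁₁, u₁₂, u₁₃, u₁₄, u₁₅, u₁₆} :=
  ⟨layer1DischargedA_holds, layer1DischargedB_v2_holds⟩

/-- **The whole L1 slice of the Cor. 3.12 cone from its v2 residual alone**: `Layer1Residual_v2 → Layer1ConeA_v2 ∧ Layer1ConeB_v2`.
[claim: Mochizuki2012, status: disputed] -/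
theorem layer1Cone_v2_of (h : Layer1Residual_v2.{u₁, u₂, u₃, u₄, u₅}) :
    Layer1ConeA_v2.{u₁, u₂, u₃, u₄, u₅} ∧ Layer1ConeB_v2.{u₁, u₂, u₃, u₄, u₅, u₆, u₇, u₈, u₉, u₁₀, u₁₁, u₁₂, u₁₃, u₁₄, u₁₅, u₁₆} :=
  ⟨layer1ConeA_v2_of h.1, layer1ConeB_v2_of h.2⟩

end Summit.ABC.IUTFork.Conditional
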